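import Summits.BirchSwinnertonDyer.BirchSwinnertonDyer.Theorems.Rank1ResidualX1Defs
import Literature.NumberTheory.EllipticCurves.LeadingTermPPartProofs
import Literature.NumberTheory.EllipticCurves.Greenberg1999.TwoTorsionMuInvariant
import HarnessLib

/-!
# Route `AlignedTransportAtTwo`, crux C3′ `BSDOfMainConjectureRankOneAtTwo` (stmt-BirchSwinnertonDyer-23008), line `birth`
# (planner -imc g3, v3): stub O — the ORDER TRANSFER at `2` is a theorem of the printed record (modularity only)

HONEST FRAMING (cell `bsd-f1-sign2`, HOME `run/shared/lean/pub/bsd-f1-sign2/`, prover seat `bsd-line-att-p3`; BSD is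
NOT proved by any of this; THEOREMS ONLY — no definition, no named fact, nothing asserted). The planner's BC3 skeleton
for the RESTATED crux C3′ (tribunal round-1 retarget (i): the simple zero `ord_T L₂(f_E, T) = 1` is a HYPOTHESIS)
has two stubs: (O) `stub_orderTransferAtTwo : AlgebraicSimpleZeroAtTwo` — on the cell, `ord_T L₂ = 1` and Mazur's
`2`-adic main conjecture make every cyclotomic Selmer-dual datum `Λ`-torsion with a characteristic generator `g`
having a SIMPLE zero at `T = 0` — and (L) the `2`-adic leading-term / `2`-adic Gross–Zagier step (research, not
here). This file CLOSES (O) modulo ONE published named fact, modularity in the tree's parametrisation currency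
(`hmod : nonempty_modularParametrizationData`, Breuil–Conrad–Diamond–Taylor + Edixhoven's Néron-lattice datum):

* `order_eq_order_of_iwasawaToPowerSeries_eq_C_mul` — `ι g = c · L` in `ℚ_p⟦T⟧` with `c ≠ 0` ⟹
  `ord_T L = ord_T g` (the coefficientwise embedding `ι : ℤ_p⟦T⟧ ↪ ℚ_p⟦T⟧` preserves the order; `C c` is a
  unit of `ℚ_p⟦T⟧`). Any prime; the twin of the tree's `order_eq_order_of_iwasawaToPowerSeries_eq` (`c = p^k`).
* `isTorsion_and_exists_charGenerator_order_eq_of_mazurMainConjecture` — ANY prime `p`, any globally minimal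
  `W`: `MazurMainConjecture W p` + modularity ⟹ for every cyclotomic datum `(κ, γ)` and every dual datum `D`,
  `X` is torsion and `char X = (g)` with `ord_T g = ord_T L_p(f_E, α)` for the conductor-level newform `f_E`
  (the datum's `ϖ > 0` with `ϖ · Ω_E = Ω⁺_{f_E}` is the THEOREM
  `ModularParametrizationData.exists_rat_mul_realPeriodRat_eq_plusPeriod`, Edixhoven 1991 §1 — no period-unit
  fact is needed for the ORDER, only `ϖ ≠ 0`).
* `algebraicSimpleZeroAtTwo_of_modularity` — the registered stub (O) VERBATIM as conclusion (the type
  `Cruxes.BSDOfMainConjectureRankOneAtTwo.Birth.AlgebraicSimpleZeroAtTwo` unfolded, since `Cruxes/` files are not importable), from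
  `hmod` alone; the cell binders `¬ HasCM`, good ordinary at `2`, no rational `2`-torsion, `Δ ∉ ℚ²`, `r_an = 1` are
  carried and unused (the order transfer holds for every curve).

So stub O is PRINT-grade (conditional only on modularity, like every statement that needs the newform to exist);
the crux's open content is stub L alone. References: B. Mazur, J. Tate, J. Teitelbaum, Invent. Math. 84 (1986)
§I.12 (`Λ ⊗ ℚ`); B. Edixhoven, in: *Arithmetic Algebraic Geometry* (1991) §1 (Manin constant); C. Breuil,
B. Conrad, F. Diamond, R. Taylor, JAMS 14 (2001) Thm. A; F. Castella, G. Grossi, C. Skinner, Math. Ann. 393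
(2025), Introduction (MC).
-/

set_option autoImplicit false
-- the route's Theorems namespace repeats a component by design (summit = sub-problem, D-0017).
set_option linter.dupNamespace false

noncomputable section

open scoped Classical MatrixGroups ModularForm

open CongruenceSubgroup WeierstrassCurve Literature.NumberTheory.EllipticCurves
  Literature.NumberTheory.EllipticCurves.ModularForms
  Literature.NumberTheory.EllipticCurves.Greenberg1999
  Summit.BirchSwinnertonDyer.BirchSwinnertonDyer.Theorems.Rank1ResidualX1Defs

namespace Summit.BirchSwinnertonDyer.BirchSwinnertonDyer.Theorems.AlignedTransportAtTwoOrderTransfer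

/-! ## §1 Orders under `ι : ℤ_p⟦T⟧ ↪ ℚ_p⟦T⟧` twisted by a non-zero constant -/

/-- **`ord_T L = ord_T g` when `ι g = c · L` with `c ≠ 0`.** The coefficientwise embedding
`ι = iwasawaToPowerSeries p : ℤ_p⟦T⟧ → ℚ_p⟦T⟧` preserves the order of vanishing at `T = 0` (injectivity on
coefficients), and `C c` is a unit of `ℚ_p⟦T⟧` for `c ∈ ℚ_pˣ`. (With `g` a characteristic generator and
`L = L_p(f, α)`, `c = ϖ` the Néron period ratio, this is the order-of-vanishing content of Mazur's main conjecture
in `Λ ⊗ ℚ_p`.) [cite: MazurTateTeitelbaum1986Invent, §I.12] -/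
theorem order_eq_order_of_iwasawaToPowerSeries_eq_C_mul (p : ℕ) [Fact p.Prime] {g : IwasawaAlgebra p}
    {c : ℚ_[p]} (hc : c ≠ 0) {L : PowerSeries ℚ_[p]}
    (hιg : iwasawaToPowerSeries p g = PowerSeries.C c * L) : L.order = g.order := by
  -- `ord_T ι(g) = ord_T g`
  have hι : (iwasawaToPowerSeries p g).order = g.order := by
    refine le_antisymm ?_ (PowerSeries.le_order_map _)
    refine PowerSeries.le_order _ _ fun i hi => ?_
    have h := PowerSeries.coeff_of_lt_order i hi
    have hinj : Function.Injective (algebraMap ℤ_[p] ℚ_[p]) := Subtype.coe_injective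
    rw [PowerSeries.coeff_map] at h
    exact hinj (h.trans (map_zero (algebraMap ℤ_[p] ℚ_[p])).symm)
  -- `ord_T (c · L) = ord_T L`
  have hcu : IsUnit (PowerSeries.C c) := IsUnit.map PowerSeries.C (IsUnit.mk0 _ hc)
  rw [← hι, hιg, PowerSeries.order_mul, PowerSeries.order_zero_of_unit hcu, zero_add]

/-! ## §2 The main conjecture transfers the analytic order to the characteristic generator (any prime) -/

section AnyPrime

variable (W : WeierstrassCurve ℚ) [W.IsElliptic] [W.IsGloballyMinimal] (p : ℕ) [Fact p.Prime]

/-- **Order transfer through Mazur's main conjecture, any prime.** Given a modular parametrisation datum `Dm` of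
`W` at level `N_E` (its newform `f_E = Dm.f` comes with a rational `ϖ > 0`, `ϖ · Ω_E = Ω⁺_{f_E}`, by the THEOREM
`ModularParametrizationData.exists_rat_mul_realPeriodRat_eq_plusPeriod`): if `MazurMainConjecture W p` holds,
then for the cyclotomic `ℤ_p`-extension, every topological generator matching the cyclotomic variable and every
Pontryagin-dual datum `D`, `X(E/ℚ_∞)` is `Λ`-torsion and `char X = (g)` with
`ord_T g = ord_T L_p(f_E, α)` (`α = unitRoot W p`). [cite: CastellaGrossiSkinner2025, Introduction (MC)]
[cite: EdixhovenManin1991, §1] [cite: MazurTateTeitelbaum1986Invent, §I.12] -/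
theorem isTorsion_and_exists_charGenerator_order_eq_of_mazurMainConjecture
    [NeZero (W.conductorNorm ℤ)] (Dm : ModularParametrizationData W (W.conductorNorm ℤ))
    (hMC : MazurMainConjecture W p)
    {κ : ZpExtension ℚ p} {γ : Field.absoluteGaloisGroup ℚ}
    (hκ : κ.IsCyclotomic) (hγ : κ.IsTopGenerator γ) (hγ' : IsCyclotomicVariable p γ)
    (D : W.SelmerDualData κ γ) :
    D.IsTorsion ∧ ∃ g : IwasawaAlgebra p, D.charIdeal = Ideal.span {g} ∧
      g.order = (padicLFunction Dm.f (unitRoot W p : ℚ_[p])).order := by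
  obtain ⟨ϖ, hϖpos, hϖ, -⟩ := Dm.exists_rat_mul_realPeriodRat_eq_plusPeriod
  obtain ⟨hX, g, hchar, hιg⟩ := hMC κ γ hκ hγ hγ' Dm.f Dm.isNewformOf ϖ hϖ D
  have hc : (ϖ : ℚ_[p]) ≠ 0 := by exact_mod_cast hϖpos.ne'
  exact ⟨hX, g, hchar, (order_eq_order_of_iwasawaToPowerSeries_eq_C_mul p hc hιg).symm⟩

/-- **Corollary (any prime): an analytic zero of order `n` at the conductor-level newform becomes an algebraic
zero of order `n`.** `hmod` + `MazurMainConjecture W p` + `ord_T L_p(f, α) = n` for every conductor-level newform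
`f` of `W` ⟹ every cyclotomic dual datum is torsion with `char X = (g)`, `ord_T g = n`.
[cite: CastellaGrossiSkinner2025, Introduction (MC)] [cite: EdixhovenManin1991, §1] -/
theorem isTorsion_and_exists_charGenerator_order_eq_of_order_padicLFunction_eq
    (hmod : nonempty_modularParametrizationData) {n : ℕ∞}
    (hL : ∀ [NeZero (W.conductorNorm ℤ)] (f : CuspForm (Gamma0 (W.conductorNorm ℤ)) 2), IsNewformOf W f →
      (padicLFunction f (unitRoot W p : ℚ_[p])).order = n)
    (hMC : MazurMainConjecture W p)
    {κ : ZpExtension ℚ p} {γ : Field.absoluteGaloisGroup ℚ}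
    (hκ : κ.IsCyclotomic) (hγ : κ.IsTopGenerator γ) (hγ' : IsCyclotomicVariable p γ)
    (D : W.SelmerDualData κ γ) :
    D.IsTorsion ∧ ∃ g : IwasawaAlgebra p, D.charIdeal = Ideal.span {g} ∧ g.order = n := by
  haveI : NeZero (W.conductorNorm ℤ) := ⟨(W.conductorNorm_pos_holds).ne'⟩
  obtain ⟨Dm⟩ := hmod W
  obtain ⟨hX, g, hchar, hord⟩ :=
    isTorsion_and_exists_charGenerator_order_eq_of_mazurMainConjecture W p Dm hMC hκ hγ hγ' D
  exact ⟨hX, g, hchar, hord.trans (hL Dm.f Dm.isNewformOf)⟩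

end AnyPrime

/-! ## §3 Stub O of line `birth` (crux C3′, stmt-BirchSwinnertonDyer-23008) verbatim, from modularity alone -/

/-- **Stub O — ORDER TRANSFER AT `2` — closed modulo modularity.** The conclusion is the registered stub statement
`AlgebraicSimpleZeroAtTwo` of `Cruxes/BSDOfMainConjectureRankOneAtTwo/Lines/birth.lean` written out: for every
cell curve `W` (non-CM, good ordinary at `2`, no rational `2`-torsion abscissa, `Δ ∉ ℚ²`, `r_an = 1`) whose
conductor-level newform has `ord_T L₂(f_E, T) = 1`, Mazur's `2`-adic main conjecture makes every cyclotomic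
Selmer-dual datum `Λ`-torsion with a characteristic generator `g`, `ord_T g = 1`. The five cell binders are not
used (the transfer holds for every curve and every order, §2). [cite: CastellaGrossiSkinner2025, Introduction (MC)]
[cite: EdixhovenManin1991, §1] [cite: MazurTateTeitelbaum1986Invent, §I.12] -/
theorem algebraicSimpleZeroAtTwo_of_modularity (hmod : nonempty_modularParametrizationData) :
    ∀ (W : WeierstrassCurve ℚ) [W.IsElliptic] [W.IsGloballyMinimal],
      ¬ W.HasCM → IsOrdinaryAt W 2 → (∀ x : ℚ, ¬ HasRationalTwoTorsionX W x) → ¬ IsSquare W.Δ →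
      W.analyticRank = 1 →
      (∀ [NeZero (W.conductorNorm ℤ)] (f : CuspForm (Gamma0 (W.conductorNorm ℤ)) 2), IsNewformOf W f →
          (padicLFunction f (unitRoot W 2 : ℚ_[2])).order = 1) →
      MazurMainConjecture W 2 →
      ∀ (κ : ZpExtension ℚ 2) (γ : Field.absoluteGaloisGroup ℚ),
        κ.IsCyclotomic → κ.IsTopGenerator γ → IsCyclotomicVariable 2 γ →
      ∀ (D : W.SelmerDualData κ γ),
        D.IsTorsion ∧ ∃ g : IwasawaAlgebra 2, D.charIdeal = Ideal.span {g} ∧ g.order = 1 :=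
  fun W _ _ _ _ _ _ _ hL hMC _ _ hκ hγ hγ' D =>
    isTorsion_and_exists_charGenerator_order_eq_of_order_padicLFunction_eq W 2 hmod hL hMC hκ hγ hγ' D

end Summit.BirchSwinnertonDyer.BirchSwinnertonDyer.Theorems.AlignedTransportAtTwoOrderTransfer

end
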